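import Summits.CriticalPhenomena.PercolationContinuityZ3.Theorems.PercNearOneGluingNoHeavyLowerTailSahiOneStepFibreThresholdAllOfF3
import HarnessLib

/-!
# One-step scheme: Kahn C5 for every threshold slot from ONE-TOKEN MONOTONICITY of the three-copy fibre form

Support file (prover prim-ineq-prove-3 gen 23; `--supports stmt-CriticalPhenomena-4575`; memo
`run/shared/lean/prim/prim-ineq-prove-3/FINDING-G23-SUPERADDITIVITY.md` §0).  No definitions, no named facts, no sorries, no `native_decide`.

`…FibreThresholdAllOfF3` reduced Kahn's Conjecture 5 / Sahi's `C₃` for every Hamming-threshold first slot to the conjecture `(F3)`: nonnegativity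
of all three-copy fibre forms `f3sum ℝ D₁ D₂ θ 1_U 1_V` on pairs of upper families.  This file reduces `(F3)` further to a ONE-TOKEN
MONOTONICITY statement: erasing an active coordinate `e` from the fibre (i.e. putting `e` into all three copies, which lowers the threshold by one
and replaces `U, V` by their `e`-sections `{S | insert e S ∈ U}`) never increases the fibre form,
  `f3sum ℝ (D₁.erase e) (D₂.erase e) (θ − 1) 1_{U_e} 1_{V_e} ≤ f3sum ℝ D₁ D₂ θ 1_U 1_V`        (memo: `M_hi`, `c_k ≥ c_{k[e→3]}`).
Iterating down to `D₁ = D₂ = ∅`, where the fibre form vanishes identically (`f3sum_empty_empty`), gives `(F3)`; the monotonicity was verified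
exhaustively for `|D₁ ∪ D₂| ≤ 5` (all upper families, all `θ`, all `e`) and sampled for `6, 7` (memo §0(i)), and it is the sharpest true
one-token statement found (the analogous comparison with the `e ↦ 0` child fails for coordinates of `D₂`).
* `f3sum_empty_empty` — the empty fibre form is `0`;
* `f3sum_indicator_nonneg_of_erase_mono` — one-token monotonicity for all fibres ⟹ `(F3)` for all fibres;
* `sahiE3_threshold_nonneg_of_erase_mono` — ⟹ `E₃(Th_t(F), A, B) ≥ 0` for every `F`, `t`, every product measure and all increasing `A, B`.
-/

namespace Summit.CriticalPhenomena.PercolationContinuityZ3.Theorems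

namespace SahiOneStep

open Finset

section Generic

variable {κ : Type*} [DecidableEq κ]

/-- The only quadruple of the empty fibre. -/
theorem f3quads_empty_empty : f3quads (∅ : Finset κ) ∅ = {((∅, ∅), (∅, ∅))} := by
  ext q
  rw [mem_f3quads, Finset.mem_singleton]
  constructor
  · rintro ⟨⟨h1, h2⟩, ⟨h3, h4⟩, -, -⟩
    rw [Finset.subset_empty] at h1 h2 h3 h4
    rcases q with ⟨⟨a, b⟩, ⟨c, d⟩⟩
    simp only at h1 h2 h3 h4
    simp [h1, h2, h3, h4]
  · rintro rfl
    simp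

/-- **The empty fibre form vanishes**: with no active coordinate the three copies coincide and the summand is identically `0`. [this work] -/
theorem f3sum_empty_empty {R : Type*} [CommRing R] (θ : ℕ) (u v : Finset κ → R) : f3sum R (∅ : Finset κ) ∅ θ u v = 0 := by
  unfold f3sum
  rw [f3quads_empty_empty, Finset.sum_singleton]
  simp only [f3term, f3S0, f3S1, f3S2, Finset.empty_sdiff, Finset.empty_union, thrR, Finset.card_empty]
  split_ifs <;> ring

/-- The `e`-section `{S ⊆ D ∖ e | insert e S ∈ U}` of an upper family of `P(D)` is an upper family of `P(D ∖ e)` (for `e ∈ D`). -/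
theorem section_upper {D : Finset κ} {U : Finset (Finset κ)} {e : κ} (he : e ∈ D)
    (hUup : ∀ S ∈ U, ∀ T ∈ D.powerset, S ⊆ T → T ∈ U) :
    ∀ S ∈ (D.erase e).powerset.filter (fun S => insert e S ∈ U), ∀ T ∈ (D.erase e).powerset, S ⊆ T →
      T ∈ (D.erase e).powerset.filter (fun S => insert e S ∈ U) := by
  intro S hS T hT hST
  rw [Finset.mem_filter] at hS ⊢
  refine ⟨hT, hUup _ hS.2 _ ?_ (Finset.insert_subset_insert e hST)⟩
  rw [Finset.mem_powerset] at hT ⊢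
  exact Finset.insert_subset he (hT.trans (Finset.erase_subset e D))

/-- On `P(D ∖ e)` the indicator of the `e`-section agrees with `S ↦ 1_U(insert e S)`. -/
theorem section_indicator_eq {R : Type*} [Zero R] [One R] {D : Finset κ} (U : Finset (Finset κ)) (e : κ) :
    ∀ S ∈ (D.erase e).powerset,
      (fun S : Finset κ => if insert e S ∈ U then (1 : R) else 0) S =
        (fun S : Finset κ => if S ∈ (D.erase e).powerset.filter (fun S => insert e S ∈ U) then (1 : R) else 0) S := by
  intro S hS
  simp only [Finset.mem_filter, hS, true_and]

/-- **`(F3)` from one-token monotonicity.**  If for all disjoint `D₁, D₂`, every active coordinate `e ∈ D₁ ∪ D₂`, every `θ` and all pairs of upper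
families `U, V` of `P(D₁ ∪ D₂)` the fibre form does not increase when `e` is erased (threshold `θ − 1`, sections at `e`), then every fibre form
on a pair of upper families is nonnegative. [this work] -/
theorem f3sum_indicator_nonneg_of_erase_mono
    (hmono : ∀ D₁ D₂ : Finset κ, Disjoint D₁ D₂ → ∀ e ∈ D₁ ∪ D₂, ∀ θ : ℕ, ∀ U V : Finset (Finset κ),
      U ⊆ (D₁ ∪ D₂).powerset → (∀ S ∈ U, ∀ T ∈ (D₁ ∪ D₂).powerset, S ⊆ T → T ∈ U) →
      V ⊆ (D₁ ∪ D₂).powerset → (∀ S ∈ V, ∀ T ∈ (D₁ ∪ D₂).powerset, S ⊆ T → T ∈ V) →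
      f3sum ℝ (D₁.erase e) (D₂.erase e) (θ - 1) (fun S => if insert e S ∈ U then 1 else 0) (fun S => if insert e S ∈ V then 1 else 0)
        ≤ f3sum ℝ D₁ D₂ θ (fun S => if S ∈ U then 1 else 0) (fun S => if S ∈ V then 1 else 0))
    (D₁ D₂ : Finset κ) (hdisj : Disjoint D₁ D₂) (θ : ℕ) (U V : Finset (Finset κ))
    (hU : U ⊆ (D₁ ∪ D₂).powerset) (hUup : ∀ S ∈ U, ∀ T ∈ (D₁ ∪ D₂).powerset, S ⊆ T → T ∈ U)
    (hV : V ⊆ (D₁ ∪ D₂).powerset) (hVup : ∀ S ∈ V, ∀ T ∈ (D₁ ∪ D₂).powerset, S ⊆ T → T ∈ V) :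
    0 ≤ f3sum ℝ D₁ D₂ θ (fun S => if S ∈ U then 1 else 0) (fun S => if S ∈ V then 1 else 0) := by
  -- induction on the number of active coordinates
  suffices h : ∀ n : ℕ, ∀ D₁ D₂ : Finset κ, (D₁ ∪ D₂).card = n → Disjoint D₁ D₂ → ∀ θ : ℕ, ∀ U V : Finset (Finset κ),
      U ⊆ (D₁ ∪ D₂).powerset → (∀ S ∈ U, ∀ T ∈ (D₁ ∪ D₂).powerset, S ⊆ T → T ∈ U) →
      V ⊆ (D₁ ∪ D₂).powerset → (∀ S ∈ V, ∀ T ∈ (D₁ ∪ D₂).powerset, S ⊆ T → T ∈ V) →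
      0 ≤ f3sum ℝ D₁ D₂ θ (fun S => if S ∈ U then 1 else 0) (fun S => if S ∈ V then 1 else 0) from
    h _ D₁ D₂ rfl hdisj θ U V hU hUup hV hVup
  intro n
  induction n with
  | zero =>
    intro D₁ D₂ hcard _ θ U V _ _ _ _
    rw [Finset.card_eq_zero, Finset.union_eq_empty] at hcard
    obtain ⟨rfl, rfl⟩ := hcard
    rw [f3sum_empty_empty]
  | succ n ih =>
    intro D₁ D₂ hcard hdisj θ U V hU hUup hV hVup
    -- pick an active coordinate `e`
    have hne : (D₁ ∪ D₂).Nonempty := by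
      rw [← Finset.card_pos, hcard]; exact Nat.succ_pos n
    obtain ⟨e, he⟩ := hne
    -- one-token monotonicity, then the induction hypothesis for the erased fibre
    refine le_trans ?_ (hmono D₁ D₂ hdisj e he θ U V hU hUup hV hVup)
    set D := D₁ ∪ D₂ with hD
    have hDe : D₁.erase e ∪ D₂.erase e = D.erase e := by
      rw [hD, Finset.erase_union_distrib]
    set U' := (D.erase e).powerset.filter (fun S => insert e S ∈ U) with hU'
    set V' := (D.erase e).powerset.filter (fun S => insert e S ∈ V) with hV'
    have hcong : f3sum ℝ (D₁.erase e) (D₂.erase e) (θ - 1) (fun S => if insert e S ∈ U then (1 : ℝ) else 0)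
          (fun S => if insert e S ∈ V then (1 : ℝ) else 0)
        = f3sum ℝ (D₁.erase e) (D₂.erase e) (θ - 1) (fun S => if S ∈ U' then (1 : ℝ) else 0) (fun S => if S ∈ V' then (1 : ℝ) else 0) := by
      rw [f3sum_congr_left (D₁.erase e) (D₂.erase e) (θ - 1) _ (u' := fun S => if S ∈ U' then (1 : ℝ) else 0)
            (fun S hS => section_indicator_eq (R := ℝ) U e S (by rwa [hDe] at hS)),
          f3sum_congr_right (D₁.erase e) (D₂.erase e) (θ - 1) _ (v' := fun S => if S ∈ V' then (1 : ℝ) else 0)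
            (fun S hS => section_indicator_eq (R := ℝ) V e S (by rwa [hDe] at hS))]
    rw [hcong]
    have hcard' : (D₁.erase e ∪ D₂.erase e).card = n := by
      rw [hDe, Finset.card_erase_of_mem he, hcard]; rfl
    have hdisj' : Disjoint (D₁.erase e) (D₂.erase e) :=
      Finset.disjoint_of_subset_left (Finset.erase_subset e D₁) (Finset.disjoint_of_subset_right (Finset.erase_subset e D₂) hdisj)
    refine ih (D₁.erase e) (D₂.erase e) hcard' hdisj' (θ - 1) U' V' ?_ ?_ ?_ ?_
    · rw [hDe]; exact Finset.filter_subset _ _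
    · rw [hDe]; exact section_upper he hUup
    · rw [hDe]; exact Finset.filter_subset _ _
    · rw [hDe]; exact section_upper he hVup

end Generic

/-! ## The measure-level consequence -/

open MeasureTheory
open Literature.Probability.LatticeModels (prodBernoulli sahiE3)
open scoped Classical

variable {ι : Type*} [Fintype ι] [DecidableEq ι]

/-- **KAHN C5 / SAHI C₃ FOR EVERY THRESHOLD FIRST SLOT FROM ONE-TOKEN MONOTONICITY OF THE FIBRE FORM.**  If erasing an active coordinate
(threshold lowered by one, upper families replaced by their sections) never increases the three-copy fibre form on pairs of upper families, then
for every finite `ι`, every `p : ι → [0,1]`, every `F`, every `t` and ALL increasing `A, B ⊆ 2^ι`: `E₃(Th_t(F), A, B) ≥ 0`. [this work] -/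
theorem sahiE3_threshold_nonneg_of_erase_mono
    (hmono : ∀ D₁ D₂ : Finset ι, Disjoint D₁ D₂ → ∀ e ∈ D₁ ∪ D₂, ∀ θ : ℕ, ∀ U V : Finset (Finset ι),
      U ⊆ (D₁ ∪ D₂).powerset → (∀ S ∈ U, ∀ T ∈ (D₁ ∪ D₂).powerset, S ⊆ T → T ∈ U) →
      V ⊆ (D₁ ∪ D₂).powerset → (∀ S ∈ V, ∀ T ∈ (D₁ ∪ D₂).powerset, S ⊆ T → T ∈ V) →
      f3sum ℝ (D₁.erase e) (D₂.erase e) (θ - 1) (fun S => if insert e S ∈ U then 1 else 0) (fun S => if insert e S ∈ V then 1 else 0)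
        ≤ f3sum ℝ D₁ D₂ θ (fun S => if S ∈ U then 1 else 0) (fun S => if S ∈ V then 1 else 0))
    (p : ι → unitInterval) (F : Finset ι) (t : ℕ) {A B : Set (Set ι)} (hA : IsUpperSet A) (hB : IsUpperSet B) :
    0 ≤ sahiE3 (prodBernoulli p) {ω : Set ι | t ≤ (F.filter (· ∈ ω)).card} A B :=
  sahiE3_threshold_nonneg_of_f3sum_nonneg
    (fun D₁ D₂ hd θ U V hU hUup hV hVup => f3sum_indicator_nonneg_of_erase_mono hmono D₁ D₂ hd θ U V hU hUup hV hVup)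
    p F t hA hB

end SahiOneStep

end Summit.CriticalPhenomena.PercolationContinuityZ3.Theorems
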